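import Literature.GroupTheory.CombinatorialGroupTheory.RibbonGraphGeometricBasisInduction
import Literature.GroupTheory.CombinatorialGroupTheory.QuadraticSystems
import Literature.GroupTheory.CombinatorialGroupTheory.PuncturedSurfaceGroupCuspBases
import Literature.GroupTheory.CombinatorialGroupTheory.PuncturedSurfaceGroupCusps
import HarnessLib

/-!
# One-vertex face systems have adapted free bases (GT-A, brick 1)

Topic `Literature/GroupTheory/CombinatorialGroupTheory`.  The geometric-basis theorem
`RibbonGraph.exists_geometricBasis` restated in the vocabulary of face systems
(`QuadraticSystems.lean`: a list of faces `Fs : List (List (E × Bool))`, pairwise distinct letters,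
every letter used, faces nonempty, vertex permutation `sysPerm Fs` transitive) and of punctured
surface groups (`PuncturedSurfaceGroup.lean`):

**Theorem** (`RibbonGraph.exists_puncturedSurfaceGroup_mulEquiv_of_faceSystem`).  For such a
one-vertex face system with `r` faces there are `g` with `2g + r = |E| + 1`, an isomorphism
`Λ : Γ_{g,r} ≃* F(E)` and a bijection `σ` of `Fin r` such that `Λ` carries the cusp generator `c_j`
to a conjugate of the face word `mk (Fs.get (σ j))` for every `j`.

This is the statement `GTAShapes.ShapeN` agreed in the abc-iut cell (GT-A = finite-index subgroups
of punctured surface groups, Hoare–Karrass–Solitar 1971 / Zieschang–Vogt–Coldewey LNM 835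
Thm 4.14.1, bricks 2–3 by other seats): the face system here is the one-vertex ribbon graph of a
finite-index subgroup after contracting a spanning tree of its Schreier graph.  The dictionary:
`sysPerm Fs` is the rotation `ρ`, `bar` is `flip`, the faces are the cycles of `face ρ` and the face
word `mk F` is the cycle word; the isomorphism `Γ_{g, m+1} ≃* F((Fin g × Bool) ⊕ Fin m)` is the
tree's `PuncturedSurfaceGroup.exists_mulEquiv_freeGroup_elim_first`.
-/

namespace Literature.GroupTheory.CombinatorialGroupTheory

namespace RibbonGraph

open Equiv Equiv.Perm Function List

/-! ### Reindexing the cusps of a punctured surface group along an equality -/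

/-- `Γ_{g,r} ≃* Γ_{g,r'}` for `r = r'` (transport). [cite: ZieschangVogtColdewey1980, Prop. 3.2.4 and canonical presentation 3.2.6'] -/
def castIso (g : ℕ) {r r' : ℕ} (h : r = r') : PuncturedSurfaceGroup g r ≃* PuncturedSurfaceGroup g r' := by
  subst h; exact MulEquiv.refl _

/-- `castIso_c`: bookkeeping lemma of this construction (see the module docstring). [cite: ZieschangVogtColdewey1980, Prop. 3.2.4 and canonical presentation 3.2.6'] -/
theorem castIso_c (g : ℕ) {r r' : ℕ} (h : r = r') (j : Fin r) :
    castIso g h (PuncturedSurfaceGroup.c j) = PuncturedSurfaceGroup.c (Fin.cast h j) := by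
  subst h; rfl

/-! ### Face systems as one-vertex ribbon graphs -/

section FaceSystem

variable {E : Type} [DecidableEq E] (Fs : List (List (Dart E)))

/-- `face_sysPerm_apply`: bookkeeping lemma of this construction (see the module docstring). [cite: ZieschangVogtColdewey1980, Prop. 3.2.4 and canonical presentation 3.2.6'] -/
theorem face_sysPerm_apply (d : Dart E) : face (sysPerm Fs) d = (Fs.map List.formPerm).prod d := by
  rw [face_apply, sysPerm_apply]
  congr 1
  rcases d with ⟨x, b⟩; simp [bar]

variable {Fs} (hd : Fs.flatten.Nodup)
include hd

/-- `face_sysPerm_apply_of_mem`: bookkeeping lemma of this construction (see the module docstring). [cite: ZieschangVogtColdewey1980, Prop. 3.2.4 and canonical presentation 3.2.6'] -/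
theorem face_sysPerm_apply_of_mem {F : List (Dart E)} (hF : F ∈ Fs) {x : Dart E} (hx : x ∈ F) :
    face (sysPerm Fs) x = F.formPerm x := by
  rw [face_sysPerm_apply, prod_formPerm_apply_of_mem hd hF hx]

omit [DecidableEq E] in
/-- `nodup_of_mem_faces`: bookkeeping lemma of this construction (see the module docstring). [cite: ZieschangVogtColdewey1980, Prop. 3.2.4 and canonical presentation 3.2.6'] -/
theorem nodup_of_mem_faces {F : List (Dart E)} (hF : F ∈ Fs) : F.Nodup :=
  (List.nodup_flatten.mp hd).1 F hF

omit [DecidableEq E] in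
/-- Two faces sharing a letter are the same face. [cite: ZieschangVogtColdewey1980, Prop. 3.2.4 and canonical presentation 3.2.6'] -/
theorem faceIndex_unique {i j : Fin Fs.length} {x : Dart E} (hi : x ∈ Fs.get i) (hj : x ∈ Fs.get j) :
    i = j := by
  by_contra hij
  have hpw := (List.nodup_flatten.mp hd).2
  rcases lt_or_gt_of_ne hij with h | h
  · exact (List.pairwise_iff_get.mp hpw i j h) hi hj
  · exact (List.pairwise_iff_get.mp hpw j i h) hj hi

omit [DecidableEq E] hd in
/-- The free-group word of a list of darts is the product of their letters. [cite: ZieschangVogtColdewey1980, Prop. 3.2.4 and canonical presentation 3.2.6'] -/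
theorem mk_eq_prod_map_letter (F : List (Dart E)) : FreeGroup.mk F = (F.map letter).prod := by
  induction F with
  | nil => rfl
  | cons a F ih => rw [List.map_cons, List.prod_cons, ← ih, letter, FreeGroup.mul_mk, List.singleton_append]

/-- The boundary walk steps along a face: from `F[k]` to `F[k+1]`, and from the last letter back to
the first. [cite: ZieschangVogtColdewey1980, Prop. 3.2.4 and canonical presentation 3.2.6'] -/
theorem face_sysPerm_getElem {F : List (Dart E)} (hF : F ∈ Fs) (k : ℕ) (hk : k < F.length) :
    face (sysPerm Fs) (F[k]) = F[(k + 1) % F.length]'(Nat.mod_lt _ (by omega)) := by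
  rw [face_sysPerm_apply_of_mem hd hF (List.getElem_mem hk), List.formPerm_apply_getElem _ (nodup_of_mem_faces hd hF)]

/-- A face `F` is a boundary cycle of length `F.length` of the ribbon graph `(E, sysPerm Fs)`, its
word is `mk F`, and it consists of its letters. [cite: ZieschangVogtColdewey1980, Prop. 3.2.4 and canonical presentation 3.2.6'] -/
theorem face_cycle [Finite E] {F : List (Dart E)} (hF : F ∈ Fs) (hF0 : F ≠ []) :
    minimalPeriod (face (sysPerm Fs)) (F.head hF0) = F.length ∧
      cycleProd (face (sysPerm Fs)) letter (F.head hF0) = FreeGroup.mk F ∧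
      ∀ y, (face (sysPerm Fs)).SameCycle (F.head hF0) y ↔ y ∈ F := by
  have hlen : 0 < F.length := List.length_pos_of_ne_nil hF0
  let w : ℕ → Dart E := fun k => if h : k < F.length then F[k] else F.head hF0
  have hw : ∀ k (h : k < F.length), w k = F[k] := fun k h => by simp [w, h]
  have hw0 : w 0 = F.head hF0 := by rw [hw 0 hlen, List.head_eq_getElem]
  have hstep : ∀ k, k + 1 < F.length → face (sysPerm Fs) (w k) = w (k + 1) := fun k hk => by
    rw [hw k (by omega), hw (k + 1) hk, face_sysPerm_getElem hd hF k (by omega)]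
    simp [Nat.mod_eq_of_lt hk]
  have hwrap : face (sysPerm Fs) (w (F.length - 1)) = w 0 := by
    rw [hw _ (by omega), hw 0 hlen, face_sysPerm_getElem hd hF _ (by omega)]
    simp [show F.length - 1 + 1 = F.length by omega]
  have hinj : ∀ i j, i < F.length → j < F.length → w i = w j → i = j := fun i j hi hj h => by
    rw [hw i hi, hw j hj] at h
    exact (List.Nodup.getElem_inj_iff (nodup_of_mem_faces hd hF)).mp h
  rw [← hw0]
  refine ⟨minimalPeriod_eq_of_cyclicSeq _ w hlen hstep hwrap hinj, ?_, fun y => ?_⟩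
  · rw [cycleProd, minimalPeriod_eq_of_cyclicSeq _ w hlen hstep hwrap hinj, prodFrom_eq_of_seq _ letter w hstep,
      mk_eq_prod_map_letter]
    have hfun : (fun k : Fin F.length => letter (w k)) = letter ∘ fun k : Fin F.length => F[(k : ℕ)] :=
      funext fun k => by simp [hw k k.2]
    rw [hfun, ← List.map_ofFn, List.ofFn_getElem]
  · rw [sameCycle_iff_of_cyclicSeq _ w hlen hstep hwrap hinj, List.mem_iff_getElem]
    constructor
    · rintro ⟨k, hk, rfl⟩; exact ⟨k, hk, (hw k hk).symm⟩
    · rintro ⟨k, hk, rfl⟩; exact ⟨k, hk, hw k hk⟩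

end FaceSystem

/-! ### The theorem -/

/-- **One-vertex face systems have adapted free bases** (GT-A brick 1, = `GTAShapes.ShapeN`): for a
nonempty system of nonempty faces `Fs` over `E × Bool` with pairwise distinct letters, using every
letter, whose vertex permutation `sysPerm Fs` is transitive, there are `g'` with
`2g' + #faces = |E| + 1`, an isomorphism `Λ` from the punctured surface group `Γ_{g', #faces}` to
the free group `F(E)`, and a bijection `σ` of the face indices such that `Λ (c_j)` is conjugate to
the face word `mk (Fs.get (σ j))` for every cusp generator `c_j`.
[cite: ZieschangVogtColdewey1980, §3.2–3.5 and Thm 4.14.1] -/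
theorem exists_puncturedSurfaceGroup_mulEquiv_of_faceSystem {E : Type} [Fintype E] [DecidableEq E]
    (Fs : List (List (E × Bool))) (hFs : Fs ≠ []) (hd : Fs.flatten.Nodup) (hc : ∀ l, l ∈ Fs.flatten)
    (hne : ∀ W ∈ Fs, W ≠ []) (htr : ∀ l l', (sysPerm Fs).SameCycle l l') :
    ∃ (g' : ℕ) (Λ : PuncturedSurfaceGroup g' Fs.length ≃* FreeGroup E)
      (σ : Fin Fs.length ≃ Fin Fs.length),
      2 * g' + Fs.length = Fintype.card E + 1 ∧
      ∀ j : Fin Fs.length, ∃ h : FreeGroup E,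
        Λ (PuncturedSurfaceGroup.c j) = h * FreeGroup.mk (Fs.get (σ j)) * h⁻¹ := by
  classical
  -- `E` is nonempty
  obtain ⟨F₀, hF₀⟩ := List.exists_mem_of_ne_nil Fs hFs
  obtain ⟨x₀, hx₀⟩ := List.exists_mem_of_ne_nil F₀ (hne F₀ hF₀)
  haveI : Nonempty E := ⟨x₀.1⟩
  -- the geometric basis of the ribbon graph `(E, sysPerm Fs)`
  obtain ⟨g, m, ⟨G⟩⟩ := exists_geometricBasis (sysPerm Fs) htr
  -- every dart lies on exactly one face
  have hface : ∀ y : Dart E, ∃ i : Fin Fs.length, y ∈ Fs.get i := fun y => by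
    obtain ⟨F, hF, hy⟩ := List.mem_flatten.mp (hc y)
    obtain ⟨i, rfl⟩ := List.mem_iff_get.mp hF
    exact ⟨i, hy⟩
  choose faceOf hfaceOf using hface
  have hhead : ∀ i : Fin Fs.length, (face (sysPerm Fs)).SameCycle ((Fs.get i).head (hne _ (List.get_mem Fs i))) =
      fun y => y ∈ Fs.get i := fun i => funext fun y =>
    propext ((face_cycle hd (List.get_mem Fs i) (hne _ (List.get_mem Fs i))).2.2 y)
  -- slots ↔ faces
  let σ₀ : Fin (m + 1) → Fin Fs.length := fun k => faceOf (G.rep k)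
  have hσ₀ : ∀ k, (face (sysPerm Fs)).SameCycle ((Fs.get (σ₀ k)).head (hne _ (List.get_mem Fs _))) (G.rep k) :=
    fun k => by rw [hhead]; exact hfaceOf _
  have hσ₀bij : Function.Bijective σ₀ := by
    constructor
    · intro k l hkl
      exact G.rep_inj k l ((hσ₀ k).symm.trans (hkl ▸ hσ₀ l))
    · intro i
      obtain ⟨k, hk⟩ := G.rep_surj ((Fs.get i).head (hne _ (List.get_mem Fs i)))
      refine ⟨k, faceIndex_unique hd (hfaceOf (G.rep k)) ?_⟩
      have := hk.symm
      rw [hhead] at this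
      exact this
  let e₀ : Fin (m + 1) ≃ Fin Fs.length := Equiv.ofBijective σ₀ hσ₀bij
  have hlen : Fs.length = m + 1 := by simpa using (Fintype.card_congr e₀).symm
  -- the isomorphism `Γ_{g, m+1} ≃* F(GBIndex g m) ≃* F(E)`
  obtain ⟨eΓ, ha, hb, hcs⟩ := PuncturedSurfaceGroup.exists_mulEquiv_freeGroup_elim_first g m
  let bnot : Bool ≃ Bool := ⟨not, not, Bool.not_not, Bool.not_not⟩
  let κ : FreeGroup ((Fin g × Bool) ⊕ Fin m) ≃* FreeGroup (GBIndex g m) :=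
    FreeGroup.freeGroupCongr (Equiv.sumCongr (Equiv.prodCongr (Equiv.refl _) bnot) (Equiv.refl _))
  let Λ₀ : PuncturedSurfaceGroup g (m + 1) ≃* FreeGroup E := eΓ.trans (κ.trans G.β)
  have hΛa : ∀ i, Λ₀ (PuncturedSurfaceGroup.a i) = G.β (FreeGroup.of (Sum.inl (i, true))) := fun i => by
    simp [Λ₀, κ, ha, bnot]
  have hΛb : ∀ i, Λ₀ (PuncturedSurfaceGroup.b i) = G.β (FreeGroup.of (Sum.inl (i, false))) := fun i => by
    simp [Λ₀, κ, hb, bnot]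
  have hΛc : ∀ j : Fin m, Λ₀ (PuncturedSurfaceGroup.c j.succ) = G.β (FreeGroup.of (Sum.inr j)) := fun j => by
    simp [Λ₀, κ, hcs]
  -- the relator determines the image of `c 0`
  have hrel : Λ₀ (PuncturedSurfaceGroup.c 0) = (G.β (handleWord g m))⁻¹ * (G.β (boundaryWord g m))⁻¹ := by
    let f : puncturedSurfaceGen g (m + 1) → FreeGroup E := fun x => Λ₀ (PresentedGroup.of x)
    have hf : FreeGroup.lift f = Λ₀.toMonoidHom.comp (PresentedGroup.mk _) := by
      ext x; simp [f, PresentedGroup.of]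
    have h1 : FreeGroup.lift f (PuncturedSurfaceGroup.relator g (m + 1)) = 1 := by
      rw [hf, MonoidHom.comp_apply, PresentedGroup.one_of_mem (Set.mem_singleton _)]
      exact map_one Λ₀
    rw [PuncturedSurfaceGroup.lift_relator] at h1
    have hH : ((List.finRange g).map fun i => f (Sum.inl (i, false)) * f (Sum.inl (i, true)) *
        (f (Sum.inl (i, false)))⁻¹ * (f (Sum.inl (i, true)))⁻¹).prod = G.β (handleWord g m) := by
      rw [handleWord, map_list_prod, List.map_ofFn, List.ofFn_eq_map]
      congr 1
      apply List.map_congr_left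
      intro i _
      show Λ₀ (PuncturedSurfaceGroup.a i) * Λ₀ (PuncturedSurfaceGroup.b i) * (Λ₀ (PuncturedSurfaceGroup.a i))⁻¹ *
          (Λ₀ (PuncturedSurfaceGroup.b i))⁻¹ = _
      rw [hΛa, hΛb]
      simp
    have hB : ((List.finRange (m + 1)).map fun j => f (Sum.inr j)).prod =
        Λ₀ (PuncturedSurfaceGroup.c 0) * G.β (boundaryWord g m) := by
      rw [List.finRange_succ, List.map_cons, List.prod_cons, List.map_map, boundaryWord, map_list_prod,
        List.map_ofFn, List.ofFn_eq_map]
      congr 1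
      congr 1
      apply List.map_congr_left
      intro j _
      show Λ₀ (PuncturedSurfaceGroup.c j.succ) = _
      rw [hΛc]
      rfl
    rw [hH, hB] at h1
    calc Λ₀ (PuncturedSurfaceGroup.c 0)
        = (G.β (handleWord g m))⁻¹ * (G.β (handleWord g m) * (Λ₀ (PuncturedSurfaceGroup.c 0) *
            G.β (boundaryWord g m))) * (G.β (boundaryWord g m))⁻¹ := by group
      _ = (G.β (handleWord g m))⁻¹ * (G.β (boundaryWord g m))⁻¹ := by rw [h1]; group
  -- the cycle word of slot `k` is conjugate to the face word of `σ₀ k`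
  have hcyc : ∀ k : Fin (m + 1), ∃ u : FreeGroup E,
      cycleProd (face (sysPerm Fs)) letter (G.rep k) = u⁻¹ * FreeGroup.mk (Fs.get (σ₀ k)) * u := by
    intro k
    obtain ⟨u, hu⟩ := exists_cycleProd_eq_conj_of_sameCycle (face (sysPerm Fs)) letter (hσ₀ k)
    refine ⟨u, ?_⟩
    rw [hu, (face_cycle hd (List.get_mem Fs _) (hne _ (List.get_mem Fs _))).2.1]
  -- assemble
  refine ⟨g, (castIso g hlen).trans Λ₀, (finCongr hlen).trans ((rotSlot m).trans e₀), ?_, fun j => ?_⟩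
  · have := G.card_eq
    rw [Nat.card_eq_fintype_card] at this
    omega
  · simp only [MulEquiv.trans_apply, castIso_c, Equiv.trans_apply, finCongr_apply]
    generalize Fin.cast hlen j = i
    cases i using Fin.cases with
    | zero =>
      rw [hrel, rotSlot_zero]
      obtain ⟨u, hu⟩ := hcyc (Fin.last m)
      have hl := G.last_eq
      rw [hu, surfaceWord, map_mul] at hl
      refine ⟨(G.β (handleWord g m))⁻¹ * G.t (Fin.last m) * u⁻¹, ?_⟩
      have hl' : FreeGroup.mk (Fs.get (σ₀ (Fin.last m))) = (G.t (Fin.last m) * u⁻¹)⁻¹ *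
          (G.β (handleWord g m) * G.β (boundaryWord g m))⁻¹ * (G.t (Fin.last m) * u⁻¹) := by
        rw [← hl]; group
      show _ = _ * FreeGroup.mk (Fs.get (σ₀ (Fin.last m))) * _
      rw [hl']
      group
    | succ j' =>
      rw [rotSlot_succ, hΛc]
      obtain ⟨u, hu⟩ := hcyc j'.castSucc
      have hf := G.free_eq j'
      rw [hu] at hf
      refine ⟨G.t j'.castSucc * u⁻¹, ?_⟩
      show _ = _ * FreeGroup.mk (Fs.get (σ₀ j'.castSucc)) * _
      rw [← hf]
      group

end RibbonGraph

end Literature.GroupTheory.CombinatorialGroupTheory
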